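import Summits.HodgeConjecture.HodgeConjecture.Theorems.F0P2oCMBlockFrameGram   -- ★ p838316 B-p08 (g25): `localLineInl_prodUnique_inlLoc_blockFrame`, `reindex_prodUnique_kronecker_{one,three}_…`; brings ★ (BF) p837182 A-p16 (g24)
import HarnessLib

/-!
# Crux `H413` — N3 ROAD (a), row (DK): TORUS DOCKING at the block frame — `ch_{T₀}(d(1, β, 1))` followed by `localLineInl e_std` IS `BlockSum.inlLoc (β̃ ⊗ 1)`

F0∕P2, cell `hodgecm-mathlib`, crux item `stmt-HodgeConjecture-24833`; A-p01 (g19) on the K1∕N3 lead B-p18 (g29)'s dealing 2026-09-01T00:13:36Z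
(separable insurance brick for (C5), B-p10 (g23)).  PROOF lane (theorems only; no `def`, no instance, no notation, no `sorry`);
`--supports stmt-HodgeConjecture-24833 --as helper`.  HONEST LABEL: HC_CM is proved only modulo the printed citations until rung 0 closes; this file proves NO
letter — it is plumbing for the closer of N3 #96 (a).

THE MATHEMATICS (one paragraph).  In the `hL` binder of ★ `thetaType_nonsplit_jacquetModule_of_lineJacquet` the torus element `t ∈ T(L⁺_v) ⊂ U(Φ₃)(L⁺_v)` is tied to
the rank-one unitary `u ∈ U(⟨ε⟩)(L⁺_v)` by the clause `d(1, det u, 1) = t`.  By ★ `torusEntry_eq_of_glDiagonal_eq` this says `t₀₀ = 1` and `t₁₁ = β := det u ∈ E¹_v`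
(`σβ·β = 1`, ★ `localDet`), so conjunct (i) of A-p16 (g24)'s ★ (BF) `exists_blockAdaptedCongr` — taken here VERBATIM as the hypothesis `hinl` on a free block frame
`(T₀, a, h₀)` — docks `t` at the rank-one SCALAR unitary `β̃ := β·1₁ ∈ U(diag(dV₀))(L⁺_v)` (★ `scalar_mem_unitaryGroupOfForm`): `ch_{T₀}(t) = β̃ ⊕ 1₂ = BlockSum.inlLocal β̃`.
Transport to the factor groups (★ `localPiEquiv_symm_eq_inlLoc`) and B-p08 (g25)'s group square at the CM block frame (★ `localLineInl_prodUnique_inlLoc_blockFrame`: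
`localLineInl_{pU₃} ∘ inlLoc^{V} = inlLoc^{V ⊗ W} ∘ localLineInl_{pU₁}`) give the (DK) identity with the witness `g₁ := localPiEquiv⁻¹ β̃`, whose matrix entry is `β = det u`.

References: [Rogawski1990] §1.10 p. 9 (the diagonal torus `d(α, β, ᾱ⁻¹)`); [Kudla1984] §1 (see-saw block embedding `U(V₁) × U(V₂) ⊂ U(V₁ ⊕ V₂)`);
[GelbartRogawski1991] §3.2 p. 457 (the first member `a : U(V) → U(V ⊗ W)`); [Mok2014] §1 Notation p. 5 (`E¹_v` scalars are unitary).
-/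

set_option autoImplicit false
-- the mandated namespace repeats `HodgeConjecture.HodgeConjecture`, as in every `Theorems/*.lean` of this sub-problem
set_option linter.dupNamespace false

noncomputable section

open NumberField IsDedekindDomain Matrix
open scoped MatrixGroups Kronecker
open Literature.NumberTheory.Automorphic Literature.NumberTheory.Automorphic.UnitaryGroup
open Literature.NumberTheory.GelbartRogawski1991 Literature.NumberTheory.GelbartRogawski1991.UnitaryDualPair
open Literature.NumberTheory.GelbartRogawski1991.UnitaryDualPair.LocalSplitting
open Literature.NumberTheory.Automorphic.Liu2021 Literature.NumberTheory.Automorphic.Liu2021.Def411WeilCarriers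
open Literature.NumberTheory.Rogawski1990 Literature.NumberTheory

namespace Summit.HodgeConjecture.HodgeConjecture.Cruxes.H413.F0P2oBlockFrameTorusDocking

open Summit.HodgeConjecture.HodgeConjecture.Cruxes.H413.F0P2oBlockAdaptedCongruence
open Summit.HodgeConjecture.HodgeConjecture.Cruxes.H413.F0P2oCMBlockFrameGram

variable (L : Type) [Field L] [NumberField L] [IsCMField L] (v : HeightOneSpectrum (𝓞 ↥(maximalRealSubfield L)))
  (dV : Fin 3 → L) (hdV : ∀ i, IsCMField.complexConj L (dV i) = dV i) (ε : (↥(maximalRealSubfield L))ˣ)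

/-! ## §1 The rank-one scalar unitary `β̃ = β · 1₁` -/

/-- **the scalar `β·1₁` (`σβ·β = 1`) lies in `U(J₁)(L⁺_v)` for every rank-one `J₁`** (★ `scalar_mem_unitaryGroupOfForm` read through ★ `UnitaryGroup.«local»`).
[cite: Mok2014, §1 Notation p. 5] -/
theorem scalar_mem_local_one (J₁ : Matrix (Fin 1) (Fin 1) L) (β : (LocalRing L v)ˣ)
    (hβ : conjLocal L (IsCMField.complexConj L) v (β : LocalRing L v) * β = 1) :
    Units.map (Matrix.scalar (Fin 1) : LocalRing L v →+* Matrix (Fin 1) (Fin 1) (LocalRing L v)).toMonoidHom β ∈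
      UnitaryGroup.«local» L (IsCMField.complexConj L) 1 J₁ v :=
  scalar_mem_unitaryGroupOfForm _ _ β hβ

omit [IsCMField L] in
/-- the `(0,0)` entry of the scalar `β·1₁` is `β`. [folklore] -/
theorem scalar_val_zero_zero (β : (LocalRing L v)ˣ) :
    (Units.map (Matrix.scalar (Fin 1) : LocalRing L v →+* Matrix (Fin 1) (Fin 1) (LocalRing L v)).toMonoidHom β).val 0 0 = (β : LocalRing L v) := by
  rw [Units.coe_map, RingHom.toMonoidHom_eq_coe, MonoidHom.coe_coe, Matrix.scalar_apply, Matrix.diagonal_apply_eq]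

/-! ## §2 Reading the torus clause `d(1, β, 1) = t` -/

/-- `d(1, β, 1) = t` ⇒ `t₀₀ = 1`. [cite: Rogawski1990, §1.10 p. 9] -/
theorem torusEntry_zero_eq_one_of_glDiagonal_eq (β : (LocalRing L v)ˣ) (t : ↥(cmBorelTriple L 3 v).M)
    (ht : glDiagonal 3 (LocalRing L v) ![1, β, 1] =
      ((t : ↥(unitaryGroupOfForm (conjLocal L (IsCMField.complexConj L) v) (cmLocalForm L 3 v))) : GL (Fin 3) (LocalRing L v))) :
    torusEntry (conjLocal L (IsCMField.complexConj L) v) (cmLocalForm L 3 v) 0 t = 1 := by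
  rw [torusEntry_eq_of_glDiagonal_eq (conjLocal L (IsCMField.complexConj L) v) (cmLocalForm L 3 v) 0 t ![1, β, 1] ht]
  rfl

/-- `d(1, β, 1) = t` ⇒ `t₁₁ = β`. [cite: Rogawski1990, §1.10 p. 9] -/
theorem torusEntry_one_eq_of_glDiagonal_eq (β : (LocalRing L v)ˣ) (t : ↥(cmBorelTriple L 3 v).M)
    (ht : glDiagonal 3 (LocalRing L v) ![1, β, 1] =
      ((t : ↥(unitaryGroupOfForm (conjLocal L (IsCMField.complexConj L) v) (cmLocalForm L 3 v))) : GL (Fin 3) (LocalRing L v))) :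
    torusEntry (conjLocal L (IsCMField.complexConj L) v) (cmLocalForm L 3 v) 1 t = β := by
  rw [torusEntry_eq_of_glDiagonal_eq (conjLocal L (IsCMField.complexConj L) v) (cmLocalForm L 3 v) 1 t ![1, β, 1] ht]
  rfl

/-! ## §3 HEAD: the torus docks at the block frame -/

/-- **(DK) TORUS DOCKING AT THE BLOCK FRAME.**  For a block frame `T₀` of `diag(dV)` (free `T₀, a, h₀`; conjunct (i) `hinl` of A-p16 (g24)'s ★ (BF)
`exists_blockAdaptedCongr` VERBATIM as hypothesis), a rank-one unitary `u ∈ U(⟨ε⟩)(L⁺_v)` and a torus element `t` with `d(1, det u, 1) = t` (the `hL` torus clause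
VERBATIM): there is `g₁ ∈ U(diag(dV₀))(L⁺_v)` with matrix entry `det u` such that `localLineInl_{e_std} (ch_{T₀} t) = BlockSum.inlLoc (localLineInl_{pU₁} g₁)` at the
pair-level block `hJ`'s of record (★ `reindex_prodUnique_kronecker_one_eq_gram_map`, ★ `reindex_prodUnique_kronecker_three_eq_finSum_map`, so that (LS) ★
`toRep_localSplittingCMWith_inlLoc_boxSB_of_eq` applies with `hTsum := gram_prodUnique_realDiagonal_eq_finSum`).  Witness `g₁ := localPiEquiv⁻¹ (det u · 1₁)`; steps
★ `torusEntry_eq_of_glDiagonal_eq` ×2 → `hinl` → ★ `localPiEquiv_symm_eq_inlLoc` → ★ `localLineInl_prodUnique_inlLoc_blockFrame`.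
[cite: Rogawski1990, §1.10 p. 9] [cite: Kudla1984, §1] [cite: GelbartRogawski1991, §3.2 p. 457] -/
theorem exists_torusDocking_blockFrame (T₀ : GL (Fin 3) (LocalRing L v)) {a : LocalRing L v} (ha₀ : IsUnit a)
    (h₀ : formCongr (conjLocal L (IsCMField.complexConj L) v) T₀ ((Matrix.diagonal dV).map (algebraMap L (LocalRing L v))) =
      a • (Matrix.of fun i j : Fin 3 => if i.val + j.val + 1 = 3 then (1 : L) else 0).map (algebraMap L (LocalRing L v)))
    (hinl : ∀ (τ : ↥(cmBorelTriple L 3 v).M)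
        (τ₁ : ↥(UnitaryGroup.«local» L (IsCMField.complexConj L) 1 (Matrix.diagonal fun _ : Fin 1 => dV 0) v)),
      torusEntry (conjLocal L (IsCMField.complexConj L) v) (cmLocalForm L 3 v) 0 τ = 1 →
      (τ₁ : GL (Fin 1) (LocalRing L v)).val 0 0 =
        ((torusEntry (conjLocal L (IsCMField.complexConj L) v) (cmLocalForm L 3 v) 1 τ : (LocalRing L v)ˣ) : LocalRing L v) →
      cmDatumLocalCongr L v T₀ ha₀ h₀ (τ : ↥(unitaryGroupOfForm (conjLocal L (IsCMField.complexConj L) v) (cmLocalForm L 3 v))) =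
        BlockSum.inlLocal (↥(maximalRealSubfield L)) L (IsCMField.complexConj L) v 1 2
          (realDiagonal_map L (fun _ : Fin 1 => dV 0) (fun _ => hdV 0)).symm (diagonal_eq_finSum_realDiagonal_map L dV hdV) τ₁)
    (u : localPi L (IsCMField.complexConj L) 1 (JW (↥(maximalRealSubfield L)) L ε) v) (t : ↥(cmBorelTriple L 3 v).M)
    (ht : glDiagonal 3 (LocalRing L v) ![1, ((localDet (IsCMField.complexConj L) v
          (isUnit_iff_ne_zero.mpr (by rw [Matrix.det_fin_one]; exact JW_apply_ne_zero (↥(maximalRealSubfield L)) L ε))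
          (localPiEquiv L (IsCMField.complexConj L) 1 (JW (↥(maximalRealSubfield L)) L ε) v u) :
            ↥(normOneUnits (conjLocal L (IsCMField.complexConj L) v))) : (LocalRing L v)ˣ), 1] =
          ((t : ↥(unitaryGroupOfForm (conjLocal L (IsCMField.complexConj L) v) (cmLocalForm L 3 v))) : GL (Fin 3) (LocalRing L v))) :
    ∃ g₁ : localPi L (IsCMField.complexConj L) 1 (Matrix.diagonal fun _ : Fin 1 => dV 0) v,
      (localPiEquiv L (IsCMField.complexConj L) 1 (Matrix.diagonal fun _ : Fin 1 => dV 0) v g₁ :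
          GL (Fin 1) (LocalRing L v)).val 0 0 =
        ((localDet (IsCMField.complexConj L) v
          (isUnit_iff_ne_zero.mpr (by rw [Matrix.det_fin_one]; exact JW_apply_ne_zero (↥(maximalRealSubfield L)) L ε))
          (localPiEquiv L (IsCMField.complexConj L) 1 (JW (↥(maximalRealSubfield L)) L ε) v u) :
            ↥(normOneUnits (conjLocal L (IsCMField.complexConj L) v))) : (LocalRing L v)ˣ) ∧
      localLineInl L (IsCMField.complexConj L) 3 (Equiv.prodUnique (Fin 3) (Fin 1)) (Matrix.diagonal dV) (JW (↥(maximalRealSubfield L)) L ε) v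
          ((localPiEquiv L (IsCMField.complexConj L) 3 (Matrix.diagonal dV) v).symm
            (cmDatumLocalCongr L v T₀ ha₀ h₀ (t : ↥(unitaryGroupOfForm (conjLocal L (IsCMField.complexConj L) v) (cmLocalForm L 3 v))))) =
        BlockSum.inlLoc (↥(maximalRealSubfield L)) L (IsCMField.complexConj L) v 1 2
          (reindex_prodUnique_kronecker_one_eq_gram_map L dV hdV ε) (reindex_prodUnique_kronecker_three_eq_finSum_map L dV hdV ε)
          (localLineInl L (IsCMField.complexConj L) 1 (Equiv.prodUnique (Fin 1) (Fin 1)) (Matrix.diagonal fun _ : Fin 1 => dV 0)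
            (JW (↥(maximalRealSubfield L)) L ε) v g₁) := by
  -- `β := det u ∈ E¹_v`
  set β : (LocalRing L v)ˣ := ((localDet (IsCMField.complexConj L) v
      (isUnit_iff_ne_zero.mpr (by rw [Matrix.det_fin_one]; exact JW_apply_ne_zero (↥(maximalRealSubfield L)) L ε))
      (localPiEquiv L (IsCMField.complexConj L) 1 (JW (↥(maximalRealSubfield L)) L ε) v u) :
        ↥(normOneUnits (conjLocal L (IsCMField.complexConj L) v))) : (LocalRing L v)ˣ) with hβ
  have hβ1 : conjLocal L (IsCMField.complexConj L) v (β : LocalRing L v) * β = 1 :=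
    (mem_normOneUnits_iff (σ := conjLocal L (IsCMField.complexConj L) v) β).1 (SetLike.coe_mem _)
  -- the torus clause: `t₀₀ = 1`, `t₁₁ = β`
  have h0 := torusEntry_zero_eq_one_of_glDiagonal_eq L v β t ht
  have h1 := torusEntry_one_eq_of_glDiagonal_eq L v β t ht
  -- the rank-one scalar unitary `β̃ = β·1₁ ∈ U(diag(dV₀))(L⁺_v)`
  set τ₁ : ↥(UnitaryGroup.«local» L (IsCMField.complexConj L) 1 (Matrix.diagonal fun _ : Fin 1 => dV 0) v) :=
    ⟨Units.map (Matrix.scalar (Fin 1) : LocalRing L v →+* Matrix (Fin 1) (Fin 1) (LocalRing L v)).toMonoidHom β,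
      scalar_mem_local_one L v _ β hβ1⟩ with hτ₁def
  have hτ₁ : (τ₁ : GL (Fin 1) (LocalRing L v)).val 0 0 =
      ((torusEntry (conjLocal L (IsCMField.complexConj L) v) (cmLocalForm L 3 v) 1 t : (LocalRing L v)ˣ) : LocalRing L v) := by
    rw [h1]
    exact scalar_val_zero_zero L v β
  -- (BF)(i): `ch_{T₀} t = inlLocal β̃`; transport to the factor groups
  have hch := hinl t τ₁ h0 hτ₁
  have hsymm : (localPiEquiv L (IsCMField.complexConj L) 3 (Matrix.diagonal dV) v).symm
      (cmDatumLocalCongr L v T₀ ha₀ h₀ (t : ↥(unitaryGroupOfForm (conjLocal L (IsCMField.complexConj L) v) (cmLocalForm L 3 v)))) =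
      BlockSum.inlLoc (↥(maximalRealSubfield L)) L (IsCMField.complexConj L) v 1 2
        (realDiagonal_map L (fun _ : Fin 1 => dV 0) (fun _ => hdV 0)).symm (diagonal_eq_finSum_realDiagonal_map L dV hdV)
        ((localPiEquiv L (IsCMField.complexConj L) 1 (Matrix.diagonal fun _ : Fin 1 => dV 0) v).symm τ₁) :=
    localPiEquiv_symm_eq_inlLoc _ _ _ τ₁ hch
  refine ⟨(localPiEquiv L (IsCMField.complexConj L) 1 (Matrix.diagonal fun _ : Fin 1 => dV 0) v).symm τ₁, ?_, ?_⟩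
  · rw [ContinuousMulEquiv.apply_symm_apply, hτ₁, h1]
  · rw [hsymm]
    exact localLineInl_prodUnique_inlLoc_blockFrame L v dV hdV ε _

end Summit.HodgeConjecture.HodgeConjecture.Cruxes.H413.F0P2oBlockFrameTorusDocking

end
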